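import Literature.Analysis.FluidPDE.TrajectoryPotentialDerivative
import Literature.Analysis.FluidPDE.NewtonPotentialRepresentation
import Literature.Analysis.FluidPDE.VorticityCalculus
import Mathlib.Analysis.Calculus.ContDiff.Convolution
import Mathlib.Analysis.Distribution.AEEqOfIntegralContDiff
import HarnessLib

/-!
# Tools for the weak time derivative of a Lagrangian velocity: differentiation under the
# integral within `[0, T)`, `curl ∘ K₃ = K₃ ∘ curl` on test fields, `⟪a × b, curl ψ⟫`, and the
# fundamental lemma for vector fields

Analysis/FluidPDE support file (everything proved; no definitions, no named facts) on the
discharge path of the named fact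
`Literature.Analysis.FluidPDE.MajdaBertozzi2002_particleTrajectoryEuler`
(`HolderEulerLagrangian.lean`; A. J. Majda, A. L. Bertozzi, *Vorticity and Incompressible Flow*,
CUP 2002, §2.5 **Prop. 2.23** "⇐", p. 72–73 of the held text). The momentum equation for the
Lagrangian velocity `v = K₃ ∗ ω` of a particle-trajectory solution will be obtained from the weak
identity `∫ ⟪∂ₜv, φ⟫ = ∫ ⟪v × ω, curl (K₃ ∗ φ)⟫ = ∫ ⟪curl (K₃ ∗ (v × ω)), φ⟫` for test fields
`φ`; this file supplies the four generic tools of that computation, none of which is specific to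
particle trajectories:

* `hasDerivWithinAt_integral_Ico_of_support` — **differentiation under the integral sign within
  `[0, T)`** for an integrand jointly continuous on `[0, T) × ℝ³` with a jointly continuous time
  derivative within `[0, T)` and slices supported in a fixed ball (interior times by Mathlib's
  dominated differentiation, the initial time by one-sided extension,
  `hasDerivWithinAt_Ico_of_hasDerivAt_Ioo`); the one-sided companion of the tree's
  `hasDerivAt_integral_of_contDiffOn` (`SpaceTimeCalculusC1.lean`, open time sets);
* `curl_biotSavart_eq_biotSavart_curl` — **`curl (K₃ ∗ φ) = K₃ ∗ curl φ` for `φ ∈ C²_c`**: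
  `K₃ ∗ Φ = −Γ ∗ curl Φ` for `Φ ∈ C¹_c` (the tree's
  `biotSavart_eq_neg_integral_newtonKernel_smul_curl`, Majda–Bertozzi (2.92)–(2.94)) and the
  Newtonian potential `Γ ∗ g` of a `C¹_c` field commutes with the curl
  (`curl_integral_newtonKernel_smul`: derivatives fall on `g`, Mathlib
  `HasCompactSupport.hasFDerivAt_convolution_right`);
* `inner_cross_curlCLM` — the pointwise identity **`⟪a × b, curl ψ⟫ = ⟪b, Dψ a⟫ − ⟪a, Dψ b⟫**
  (the algebra behind `curl (v × ω) = (ω·∇)v − (v·∇)ω` for divergence-free fields, in the form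
  that needs no derivative of `v` or `ω`);
* `eq_zero_of_forall_integral_inner_eq_zero` — a continuous vector field orthogonal to all
  smooth compactly supported vector fields vanishes (Mathlib
  `ae_eq_zero_of_integral_contDiff_smul_eq_zero`).

## Mathlib / tree search

`lean search 'curl.*biotSavart.*curl|biotSavart \(curl'`: only the div-free identities
`curl_biotSavart_eq_of_isWeaklyDivFree` (`BiotSavartHolderCurl.lean`) and
`biotSavart_curl_eq_self` (`BiotSavartRepresentation.lean`), not the commutation on test
fields; `hasDerivAt_integral_of_contDiffOn` (`SpaceTimeCalculusC1.lean`) needs an open time set.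
Used: `biotSavart_eq_neg_integral_newtonKernel_smul_curl`, `integrable_newtonKernel_smul`
(`BiotSavartNewtonKernel.lean`), `NewtonPotentialRepresentation.locallyIntegrable_newtonKernel`,
`curl_neg`, `contDiff_curl`, `continuous_curl`, `hasCompactSupport_curl`
(`VorticityCalculus.lean`), `clm_apply_coord` (`VorticityStretching.lean`), `curlCLM_apply`,
`curl_eq_curlCLM`, `hasDerivWithinAt_Ico_of_hasDerivAt_Ioo`,
`exists_forall_norm_density_le_of_isCompact` (`TrajectoryPotentialDerivative.lean`); Mathlib
`HasCompactSupport.hasFDerivAt_convolution_right`,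
`convolution_precompR_apply`, `convolution_eq_swap`,
`hasDerivAt_integral_of_dominated_loc_of_deriv_le`, `continuousWithinAt_of_dominated`,
`ae_eq_zero_of_integral_contDiff_smul_eq_zero`.

## References

* A. J. Majda, A. L. Bertozzi, *Vorticity and Incompressible Flow* (CUP 2002), §2.4.1
  Prop. 2.16 with (2.92)–(2.94) (p. 63–64 of the held text), §2.5 Prop. 2.23 (p. 72–73), §1.1
  (vector identities). [MajdaBertozziCUP2002]
* D. Gilbarg, N. S. Trudinger, *Elliptic Partial Differential Equations of Second Order*
  (2001), Lemma 4.1. [GilbargTrudinger2001]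
-/

noncomputable section

open MeasureTheory Set Function Filter Metric InnerProductSpace ContinuousLinearMap
open _root_.Topology
open scoped NNReal RealInnerProductSpace Convolution ContDiff

namespace Literature.Analysis.FluidPDE

/-! ### Differentiation under the integral sign within `[0, T)` -/

section Parametric

variable {V : Type*} [NormedAddCommGroup V] [NormedSpace ℝ V]

omit [NormedSpace ℝ V] in
/-- A slice supported in the ball and bounded there is bounded by the indicator majorant. [folklore] -/
theorem norm_le_indicator_of_support_subset {H : EuclideanSpace ℝ (Fin 3) → V} {ρ c : ℝ}
    (hs : support H ⊆ closedBall 0 ρ) (hb : ∀ x, ‖H x‖ ≤ c) (x : EuclideanSpace ℝ (Fin 3)) :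
    ‖H x‖ ≤ (closedBall (0 : EuclideanSpace ℝ (Fin 3)) ρ).indicator (fun _ => c) x := by
  by_cases hx : x ∈ closedBall (0 : EuclideanSpace ℝ (Fin 3)) ρ
  · rw [indicator_of_mem hx]; exact hb x
  · rw [indicator_of_notMem hx]
    have h0 : H x = 0 := by
      by_contra h; exact hx (hs (mem_support.2 h))
    rw [h0, norm_zero]

/-- The indicator majorant of a ball is integrable. [folklore] -/
theorem integrable_indicator_closedBall_const (ρ c : ℝ) :
    Integrable (fun x => (closedBall (0 : EuclideanSpace ℝ (Fin 3)) ρ).indicator (fun _ => c) x) :=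
  (integrable_indicator_iff measurableSet_closedBall).2
    (integrableOn_const (measure_closedBall_lt_top (x := (0 : EuclideanSpace ℝ (Fin 3))) (r := ρ)).ne)

/-- Continuity at the initial time of `t ↦ ∫ H t x dx` within `[0, T')`, for `H` jointly
continuous on `[0, T) × ℝ³` (`T' ≤ T`) with slices dominated by an indicator majorant on
`[0, T']`. [folklore] -/
theorem continuousWithinAt_integral_Ico_zero {H : ℝ → EuclideanSpace ℝ (Fin 3) → V} {T T' ρ c : ℝ}
    (hT'0 : 0 < T') (hT'T : T' < T)
    (hH : ContinuousOn (fun p : ℝ × EuclideanSpace ℝ (Fin 3) => H p.1 p.2) (Ico 0 T ×ˢ univ))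
    (hbd : ∀ t ∈ Icc 0 T', ∀ x, ‖H t x‖ ≤ (closedBall (0 : EuclideanSpace ℝ (Fin 3)) ρ).indicator (fun _ => c) x) :
    ContinuousWithinAt (fun t => ∫ x, H t x) (Ico 0 T') 0 := by
  have hIco' : Ico 0 T' ⊆ Ico 0 T := fun t ht => ⟨ht.1, ht.2.trans hT'T⟩
  have hHc : ∀ t ∈ Ico 0 T, Continuous (H t) := fun t ht =>
    hH.comp_continuous (continuous_const.prodMk continuous_id) fun x => mem_prod.2 ⟨ht, mem_univ _⟩
  have hnear : ∀ᶠ t in 𝓝[Ico 0 T'] (0 : ℝ), t ∈ Ico 0 T' := self_mem_nhdsWithin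
  refine continuousWithinAt_of_dominated
    (bound := fun x => (closedBall (0 : EuclideanSpace ℝ (Fin 3)) ρ).indicator (fun _ => c) x) ?_ ?_
    (integrable_indicator_closedBall_const ρ c) ?_
  · filter_upwards [hnear] with t ht; exact (hHc t (hIco' ht)).aestronglyMeasurable
  · filter_upwards [hnear] with t ht; exact Eventually.of_forall (hbd t (Ico_subset_Icc_self ht))
  · refine Eventually.of_forall fun x => ?_
    have h := hH (0, x) (mem_prod.2 ⟨⟨le_rfl, hT'0.trans hT'T⟩, mem_univ _⟩)
    have h2 : ContinuousWithinAt (fun t : ℝ => ((t, x) : ℝ × EuclideanSpace ℝ (Fin 3))) (Ico 0 T') 0 :=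
      (continuous_id.prodMk continuous_const).continuousWithinAt
    exact ContinuousWithinAt.comp (f := fun t : ℝ => ((t, x) : ℝ × EuclideanSpace ℝ (Fin 3))) (x := 0)
      h h2 fun t ht => mem_prod.2 ⟨hIco' ht, mem_univ _⟩

/-- **Differentiation under the integral sign within `[0, T)`.** Let `G, G' : ℝ → ℝ³ → V` be
jointly continuous on `[0, T) × ℝ³`, with `t ↦ G t x` differentiable within `[0, T)` with
derivative `G' t x` for every `x`, and all slices `G t`, `G' t` supported in the fixed ball
`B̄(0, ρ)`. Then `t ↦ ∫ G t x dx` is differentiable within `[0, T)` at every `t₀ ∈ [0, T)`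
with derivative `∫ G' t₀ x dx` (interior times: dominated by the maximum of `‖G'‖` on the
compact `[0, T'] × B̄(0, ρ)`; the initial time: one-sided extension by continuity). [folklore] -/
theorem hasDerivWithinAt_integral_Ico_of_support {G G' : ℝ → EuclideanSpace ℝ (Fin 3) → V}
    {T ρ : ℝ} (hG : ContinuousOn (fun p : ℝ × EuclideanSpace ℝ (Fin 3) => G p.1 p.2) (Ico 0 T ×ˢ univ))
    (hG' : ContinuousOn (fun p : ℝ × EuclideanSpace ℝ (Fin 3) => G' p.1 p.2) (Ico 0 T ×ˢ univ))
    (hd : ∀ t ∈ Ico 0 T, ∀ x, HasDerivWithinAt (fun s => G s x) (G' t x) (Ico 0 T) t)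
    (hs : ∀ t ∈ Ico 0 T, support (G t) ⊆ closedBall 0 ρ)
    (hs' : ∀ t ∈ Ico 0 T, support (G' t) ⊆ closedBall 0 ρ) {t₀ : ℝ} (ht₀ : t₀ ∈ Ico 0 T) :
    HasDerivWithinAt (fun t => ∫ x, G t x) (∫ x, G' t₀ x) (Ico 0 T) t₀ := by
  -- a compact sub-interval `[0, T']` containing `t₀` in its relative interior
  set T' : ℝ := (t₀ + T) / 2 with hT'
  have ht₀T' : t₀ < T' := by rw [hT']; linarith [ht₀.2]
  have hT'T : T' < T := by rw [hT']; linarith [ht₀.2]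
  have hT'0 : 0 < T' := ht₀.1.trans_lt ht₀T'
  have hIcc : Icc 0 T' ⊆ Ico 0 T := fun t ht => ⟨ht.1, ht.2.trans_lt hT'T⟩
  obtain ⟨C, hC⟩ := exists_forall_norm_density_le_of_isCompact hG isCompact_Icc hIcc hs
  obtain ⟨C', hC'⟩ := exists_forall_norm_density_le_of_isCompact hG' isCompact_Icc hIcc hs'
  have hGc : ∀ t ∈ Ico 0 T, Continuous (G t) := fun t ht =>
    hG.comp_continuous (continuous_const.prodMk continuous_id) fun x => mem_prod.2 ⟨ht, mem_univ _⟩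
  have hG'c : ∀ t ∈ Ico 0 T, Continuous (G' t) := fun t ht =>
    hG'.comp_continuous (continuous_const.prodMk continuous_id) fun x => mem_prod.2 ⟨ht, mem_univ _⟩
  have hbdG : ∀ t ∈ Icc 0 T', ∀ x,
      ‖G t x‖ ≤ (closedBall (0 : EuclideanSpace ℝ (Fin 3)) ρ).indicator (fun _ => C) x :=
    fun t ht x => norm_le_indicator_of_support_subset (hs t (hIcc ht)) (hC t ht) x
  have hbdG' : ∀ t ∈ Icc 0 T', ∀ x,
      ‖G' t x‖ ≤ (closedBall (0 : EuclideanSpace ℝ (Fin 3)) ρ).indicator (fun _ => C') x :=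
    fun t ht x => norm_le_indicator_of_support_subset (hs' t (hIcc ht)) (hC' t ht) x
  -- interior derivatives on `(0, T')`
  have hint : ∀ t ∈ Ioo 0 T', HasDerivAt (fun s => ∫ x, G s x) (∫ x, G' t x) t := by
    intro t ht
    have hU : Ioo 0 T' ∈ 𝓝 t := Ioo_mem_nhds ht.1 ht.2
    have hUS : Ioo 0 T' ⊆ Ico 0 T := fun s hs => ⟨hs.1.le, hs.2.trans hT'T⟩
    have hnhds : ∀ s ∈ Ioo 0 T', Ico 0 T ∈ 𝓝 s := fun s hs =>
      mem_of_superset (Ioo_mem_nhds hs.1 (hs.2.trans hT'T)) Ioo_subset_Ico_self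
    obtain ⟨-, h⟩ := hasDerivAt_integral_of_dominated_loc_of_deriv_le (μ := volume)
      (F := G) (F' := G') (x₀ := t) (s := Ioo 0 T')
      (bound := fun x => (closedBall (0 : EuclideanSpace ℝ (Fin 3)) ρ).indicator (fun _ => C') x)
      hU (by filter_upwards [hU] with s hs; exact (hGc s (hUS hs)).aestronglyMeasurable)
      ((integrable_indicator_closedBall_const ρ C).mono' (hGc t (hUS ht)).aestronglyMeasurable
        (Eventually.of_forall (hbdG t (Ioo_subset_Icc_self ht))))
      (hG'c t (hUS ht)).aestronglyMeasurable
      (Eventually.of_forall fun x s hs => hbdG' s (Ioo_subset_Icc_self hs) x)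
      (integrable_indicator_closedBall_const ρ C')
      (Eventually.of_forall fun x s hs => (hd s (hUS hs) x).hasDerivAt (hnhds s hs))
    exact h
  -- continuity at `0` within `[0, T')`, then one-sided extension and enlargement of the time set
  have hPc0 : ContinuousWithinAt (fun t => ∫ x, G t x) (Ico 0 T') 0 :=
    continuousWithinAt_integral_Ico_zero hT'0 hT'T hG hbdG
  have hDc0 : ContinuousWithinAt (fun t => ∫ x, G' t x) (Ico 0 T') 0 :=
    continuousWithinAt_integral_Ico_zero hT'0 hT'T hG' hbdG'
  have hT'w : HasDerivWithinAt (fun t => ∫ x, G t x) (∫ x, G' t₀ x) (Ico 0 T') t₀ :=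
    hasDerivWithinAt_Ico_of_hasDerivAt_Ioo (f' := fun t => ∫ x, G' t x) ⟨ht₀.1, ht₀T'⟩ hint hPc0 hDc0
  have hnhds : Ico 0 T' ∈ 𝓝[Ico 0 T] t₀ :=
    mem_of_superset (inter_mem_nhdsWithin (Ico 0 T) (Iio_mem_nhds ht₀T')) fun s hs => ⟨hs.1.1, hs.2⟩
  exact hT'w.mono_of_mem_nhdsWithin hnhds

end Parametric

/-! ### The Newtonian potential of a `C¹_c` field commutes with the curl -/

section CurlComm

/-- The Newtonian potential of a vector field as a Mathlib convolution:
`∫ Γ(x − s) g(s) ds = (Γ ⋆ g)(x)`. [folklore] -/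
theorem integral_newtonKernel_smul_eq_convolution (g : EuclideanSpace ℝ (Fin 3) → EuclideanSpace ℝ (Fin 3))
    (x : EuclideanSpace ℝ (Fin 3)) :
    ∫ s, newtonKernel (x - s) • g s = (newtonKernel ⋆[lsmul ℝ ℝ, volume] g) x := by
  rw [convolution_eq_swap]
  simp only [lsmul_apply]

/-- **Derivatives fall on the source**: for `g ∈ C¹_c(ℝ³; ℝ³)` the Newtonian potential
`x ↦ ∫ Γ(x − s) g(s) ds` is differentiable with `∂ᵥ ∫ Γ(x − s) g(s) ds = ∫ Γ(x − s) ∂ᵥg(s) ds`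
(Gilbarg–Trudinger Lemma 4.1; Mathlib `HasCompactSupport.hasFDerivAt_convolution_right`). [cite: GilbargTrudinger2001, Lemma 4.1] -/
theorem fderiv_integral_newtonKernel_smul_apply {g : EuclideanSpace ℝ (Fin 3) → EuclideanSpace ℝ (Fin 3)}
    (hg : ContDiff ℝ 1 g) (hgc : HasCompactSupport g) (x v : EuclideanSpace ℝ (Fin 3)) :
    fderiv ℝ (fun y => ∫ s, newtonKernel (y - s) • g s) x v =
      ∫ s, newtonKernel (x - s) • fderiv ℝ g s v := by
  have hloc := NewtonPotentialRepresentation.locallyIntegrable_newtonKernel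
  have hfun : (fun y => ∫ s, newtonKernel (y - s) • g s) = newtonKernel ⋆[lsmul ℝ ℝ, volume] g :=
    funext fun y => integral_newtonKernel_smul_eq_convolution g y
  rw [hfun, (hgc.hasFDerivAt_convolution_right (lsmul ℝ ℝ) hloc hg x).fderiv,
    convolution_precompR_apply (lsmul ℝ ℝ) hloc (hgc.fderiv (𝕜 := ℝ))
      (hg.continuous_fderiv one_ne_zero) x v,
    ← integral_newtonKernel_smul_eq_convolution]

/-- Differentiability of the Newtonian potential of a `C¹_c` field. [folklore] -/
theorem differentiable_integral_newtonKernel_smul {g : EuclideanSpace ℝ (Fin 3) → EuclideanSpace ℝ (Fin 3)}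
    (hg : ContDiff ℝ 1 g) (hgc : HasCompactSupport g) :
    Differentiable ℝ (fun y => ∫ s, newtonKernel (y - s) • g s) := by
  have hloc := NewtonPotentialRepresentation.locallyIntegrable_newtonKernel
  have hfun : (fun y => ∫ s, newtonKernel (y - s) • g s) = newtonKernel ⋆[lsmul ℝ ℝ, volume] g :=
    funext fun y => integral_newtonKernel_smul_eq_convolution g y
  rw [hfun]
  exact fun x => (hgc.hasFDerivAt_convolution_right (lsmul ℝ ℝ) hloc hg x).differentiableAt

/-- Components commute with the Bochner integral on `ℝ³`. [folklore] -/
theorem integral_apply_fin_three {α : Type*} [MeasurableSpace α] {μ : Measure α}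
    {F : α → EuclideanSpace ℝ (Fin 3)} (hF : Integrable F μ) (i : Fin 3) :
    (∫ a, F a ∂μ) i = ∫ a, F a i ∂μ := by
  have h := (EuclideanSpace.proj (𝕜 := ℝ) i).integral_comp_comm hF
  exact h.symm

/-- Integrability of the scalar component integrands `s ↦ Γ(x − s) (Dg(s) v)ᵢ` of the
differentiated Newtonian potential. [folklore] -/
theorem integrable_newtonKernel_mul_fderiv_apply {g : EuclideanSpace ℝ (Fin 3) → EuclideanSpace ℝ (Fin 3)}
    (hg : ContDiff ℝ 1 g) (hgc : HasCompactSupport g) (x v : EuclideanSpace ℝ (Fin 3)) (i : Fin 3) :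
    Integrable fun s => newtonKernel (x - s) * fderiv ℝ g s v i := by
  have hDgc : Continuous (fderiv ℝ g) := hg.continuous_fderiv one_ne_zero
  have hc : Continuous fun s => fderiv ℝ g s v i :=
    (EuclideanSpace.proj (𝕜 := ℝ) i).continuous.comp (hDgc.clm_apply continuous_const)
  have hsupp : HasCompactSupport fun s => fderiv ℝ g s v i := by
    refine (hgc.fderiv (𝕜 := ℝ)).mono fun s hs => ?_
    simp only [mem_support, ne_eq] at hs ⊢
    intro h
    exact hs (by rw [h]; rfl)
  have h := integrable_newtonKernel_smul hc hsupp x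
  simpa only [smul_eq_mul] using h

/-- Integrability of the vector integrands `s ↦ Γ(x − s) Dg(s) v`. [folklore] -/
theorem integrable_newtonKernel_smul_fderiv_apply {g : EuclideanSpace ℝ (Fin 3) → EuclideanSpace ℝ (Fin 3)}
    (hg : ContDiff ℝ 1 g) (hgc : HasCompactSupport g) (x v : EuclideanSpace ℝ (Fin 3)) :
    Integrable fun s => newtonKernel (x - s) • fderiv ℝ g s v := by
  have hDgc : Continuous (fderiv ℝ g) := hg.continuous_fderiv one_ne_zero
  refine integrable_newtonKernel_smul (hDgc.clm_apply continuous_const) ?_ x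
  refine (hgc.fderiv (𝕜 := ℝ)).mono fun s hs => ?_
  simp only [mem_support, ne_eq] at hs ⊢
  intro h
  exact hs (by rw [h]; rfl)

/-- **The Newtonian potential commutes with the curl on `C¹_c` fields**:
`curl (∫ Γ(· − s) g(s) ds)(x) = ∫ Γ(x − s) curl g(s) ds` (componentwise scalar convolution;
derivatives fall on `g`). [cite: GilbargTrudinger2001, Lemma 4.1] -/
theorem curl_integral_newtonKernel_smul {g : EuclideanSpace ℝ (Fin 3) → EuclideanSpace ℝ (Fin 3)}
    (hg : ContDiff ℝ 1 g) (hgc : HasCompactSupport g) (x : EuclideanSpace ℝ (Fin 3)) :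
    curl (fun y => ∫ s, newtonKernel (y - s) • g s) x = ∫ s, newtonKernel (x - s) • curl g s := by
  -- components of the derivative of the potential
  have hcomp : ∀ (j i : Fin 3),
      (fderiv ℝ (fun y => ∫ s, newtonKernel (y - s) • g s) x (EuclideanSpace.single j (1 : ℝ))) i =
        ∫ s, newtonKernel (x - s) * fderiv ℝ g s (EuclideanSpace.single j (1 : ℝ)) i := by
    intro j i
    rw [fderiv_integral_newtonKernel_smul_apply hg hgc x,
      integral_apply_fin_three (integrable_newtonKernel_smul_fderiv_apply hg hgc x _) i]
    rfl
  have hcurlint : Integrable fun s => newtonKernel (x - s) • curl g s :=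
    integrable_newtonKernel_smul (continuous_curl hg) (hasCompactSupport_curl hgc) x
  have hsc := fun j i => integrable_newtonKernel_mul_fderiv_apply hg hgc x (EuclideanSpace.single j (1 : ℝ)) i
  -- components of the curl of `g`
  have hcurl : ∀ s, ∀ i : Fin 3, newtonKernel (x - s) * curl g s i =
      newtonKernel (x - s) * (![fderiv ℝ g s (EuclideanSpace.single 1 (1 : ℝ)) 2 - fderiv ℝ g s (EuclideanSpace.single 2 (1 : ℝ)) 1,
        fderiv ℝ g s (EuclideanSpace.single 2 (1 : ℝ)) 0 - fderiv ℝ g s (EuclideanSpace.single 0 (1 : ℝ)) 2,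
        fderiv ℝ g s (EuclideanSpace.single 0 (1 : ℝ)) 1 - fderiv ℝ g s (EuclideanSpace.single 1 (1 : ℝ)) 0] i) := by
    intro s i
    rw [curl_eq_curlCLM, curlCLM_apply, PiLp.toLp_apply]
  ext i
  rw [integral_apply_fin_three hcurlint i]
  simp_rw [PiLp.smul_apply, smul_eq_mul, hcurl]
  rw [curl_eq_curlCLM, curlCLM_apply, PiLp.toLp_apply]
  fin_cases i
  · simp only [Fin.zero_eta, Fin.isValue, Matrix.cons_val_zero, mul_sub]
    rw [integral_sub (hsc 1 2) (hsc 2 1), hcomp 1 2, hcomp 2 1]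
  · simp only [Fin.mk_one, Fin.isValue, Matrix.cons_val_one, Matrix.cons_val_zero, mul_sub]
    rw [integral_sub (hsc 2 0) (hsc 0 2), hcomp 2 0, hcomp 0 2]
  · simp only [Fin.reduceFinMk, Fin.isValue, Matrix.cons_val, mul_sub]
    rw [integral_sub (hsc 0 1) (hsc 1 0), hcomp 0 1, hcomp 1 0]

/-- **`curl (K₃ ∗ φ) = K₃ ∗ curl φ` for `φ ∈ C²_c(ℝ³; ℝ³)`**: both sides equal
`−∫ Γ(x − s) curl curl φ(s) ds` (`K₃ ∗ Φ = −Γ ∗ curl Φ` for the `C¹_c` fields `Φ = φ` and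
`Φ = curl φ`, Majda–Bertozzi (2.92)–(2.94), and the previous commutation). [cite: MajdaBertozziCUP2002, §2.4.1 Prop. 2.16 with (2.92)–(2.94) (p. 63–64)] -/
theorem curl_biotSavart_eq_biotSavart_curl {φ : EuclideanSpace ℝ (Fin 3) → EuclideanSpace ℝ (Fin 3)}
    (hφ : ContDiff ℝ 2 φ) (hφc : HasCompactSupport φ) (x : EuclideanSpace ℝ (Fin 3)) :
    curl (biotSavart φ) x = biotSavart (curl φ) x := by
  have hφ1 : ContDiff ℝ 1 φ := hφ.of_le (by norm_num)
  have hcφ : ContDiff ℝ 1 (curl φ) := contDiff_curl (n := 1) hφ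
  have hcφc : HasCompactSupport (curl φ) := hasCompactSupport_curl hφc
  have h1 : biotSavart φ = fun y => -∫ s, newtonKernel (y - s) • curl φ s :=
    funext fun y => biotSavart_eq_neg_integral_newtonKernel_smul_curl hφ1 hφc y
  rw [h1, curl_neg, curl_integral_newtonKernel_smul hcφ hcφc x,
    biotSavart_eq_neg_integral_newtonKernel_smul_curl hcφ hcφc x]

end CurlComm

/-! ### The algebra of `⟪a × b, curl ψ⟫` -/

section CrossCurl

/-- **`⟪a × b, curl A⟫ = ⟪b, A a⟫ − ⟪a, A b⟫`** for the curl vector `curlCLM A` of a Jacobian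
`A` (pure linear algebra: `ε_{kij} aᵢ bⱼ ε_{klm} A_{ml} = aᵢ bⱼ (A_{ji} − A_{ij})`). This is the
pointwise identity `⟪v × ω, curl ψ⟫ = ⟪ω, (v·∇)ψ⟫ − ⟪v, (ω·∇)ψ⟫` by which
`∫ ⟪v × ω, curl ψ⟫` is computed without differentiating `v` or `ω`. [cite: MajdaBertozziCUP2002, §1.1 (vector identities)] -/
theorem inner_cross_curlCLM (a b : EuclideanSpace ℝ (Fin 3))
    (A : EuclideanSpace ℝ (Fin 3) →L[ℝ] EuclideanSpace ℝ (Fin 3)) :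
    ⟪cross a b, curlCLM A⟫ = ⟪b, A a⟫ - ⟪a, A b⟫ := by
  simp only [PiLp.inner_apply, RCLike.inner_apply, conj_trivial, Fin.sum_univ_three,
    clm_apply_coord A a, clm_apply_coord A b, curlCLM_apply, cross, cross_apply,
    Matrix.cons_val_zero, Matrix.cons_val_one, Matrix.cons_val_two, Matrix.head_cons,
    Matrix.tail_cons]
  ring

/-- **`⟪a × b, curl ψ(x)⟫ = ⟪b, Dψ(x) a⟫ − ⟪a, Dψ(x) b⟫`** for any field `ψ` (the curl is
`curlCLM` of the Jacobian). [cite: MajdaBertozziCUP2002, §1.1 (vector identities)] -/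
theorem inner_cross_curl (a b : EuclideanSpace ℝ (Fin 3))
    (ψ : EuclideanSpace ℝ (Fin 3) → EuclideanSpace ℝ (Fin 3)) (x : EuclideanSpace ℝ (Fin 3)) :
    ⟪cross a b, curl ψ x⟫ = ⟪b, fderiv ℝ ψ x a⟫ - ⟪a, fderiv ℝ ψ x b⟫ := by
  rw [curl_eq_curlCLM, inner_cross_curlCLM]

end CrossCurl

/-! ### The fundamental lemma for vector fields -/

section Fundamental

/-- **A continuous vector field orthogonal to all smooth compactly supported vector fields
vanishes.** If `f : ℝ³ → ℝ³` is continuous and `∫ ⟪f, φ⟫ = 0` for every `φ ∈ C_c^∞(ℝ³; ℝ³)`,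
then `f = 0` (test with `φ = g • e`: `⟪∫ g • f, e⟫ = 0` for all `e`, so `∫ g • f = 0` for all
scalar test functions `g`, and Mathlib's `ae_eq_zero_of_integral_contDiff_smul_eq_zero` with
continuity). [folklore] -/
theorem eq_zero_of_forall_integral_inner_eq_zero {f : EuclideanSpace ℝ (Fin 3) → EuclideanSpace ℝ (Fin 3)}
    (hf : Continuous f)
    (h : ∀ φ : EuclideanSpace ℝ (Fin 3) → EuclideanSpace ℝ (Fin 3), ContDiff ℝ ∞ φ →
      HasCompactSupport φ → ∫ x, ⟪f x, φ x⟫ = 0) : f = 0 := by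
  have hae : f =ᵐ[volume] 0 := by
    refine ae_eq_zero_of_integral_contDiff_smul_eq_zero hf.locallyIntegrable fun g hg hgc => ?_
    have hsc : HasCompactSupport fun x => g x • f x := hgc.mono fun x hx => by
      simp only [mem_support, ne_eq] at hx ⊢
      intro h0
      exact hx (by rw [h0, zero_smul])
    have hint : Integrable fun x => g x • f x := (hg.continuous.smul hf).integrable_of_hasCompactSupport hsc
    refine ext_inner_right ℝ fun e => ?_
    rw [inner_zero_left, real_inner_comm, ← integral_inner hint e]
    have hφ : ContDiff ℝ ∞ fun x => g x • e := hg.smul contDiff_const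
    have hφc : HasCompactSupport fun x => g x • e := hgc.mono fun x hx => by
      simp only [mem_support, ne_eq] at hx ⊢
      intro h0
      exact hx (by rw [h0, zero_smul])
    have h0 := h _ hφ hφc
    have e1 : ∀ x, ⟪e, g x • f x⟫ = ⟪f x, g x • e⟫ := fun x => by
      rw [real_inner_smul_right, real_inner_smul_right, real_inner_comm]
    simp_rw [e1]
    exact h0
  exact (hf.ae_eq_iff_eq volume continuous_zero).1 hae

end Fundamental

end Literature.Analysis.FluidPDE
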